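import Literature.AlgebraicGeometry.Modules.RigidifiedZariskiGluing
import Literature.AlgebraicGeometry.AbelianSchemes.DualPairOfGluedHat
import Literature.AlgebraicGeometry.AbelianSchemes.DualPairOfGluedHatCharts
import Literature.AlgebraicGeometry.AbelianSchemes.AbelianSchemeSteinOfNoetherian
import HarnessLib

/-!
# (Z3) FILE P-a ASSEMBLY over the rigidified Zariski glueing engine: a dual pair of `A` from a glued hat, MODULO chart compatibility

Layer `Literature/AlgebraicGeometry/AbelianSchemes`, namespace `Literature.AlgebraicGeometry.AbelianSchemes.AbelianSchemeOver`.
THEOREMS ONLY; no `sorry`.  Cell hodgecm-mathlib (D-0151), FLOOR 0 P1 sub-line `Cruxes/HDel/Lines/F3DualAbelianScheme.lean` stub (Z)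
`stub_F3Z`.  This file instantiates B-p15 (g15)'s effectivity theorem `Modules.exists_hasRank_one_of_rigidified_baseCover`
([BoschLutkebohmertRaynaud1990, §8.1 Prop. 4]: the rigidified Picard functor is a Zariski sheaf; [MumfordAV1970, §13 p. 125]) with the
product charts `Ξᵢ : Aᵢ ×_{Uᵢ} Êᵢ → A ×_S H` of a glued hat (★-shaped `prodChart`, `isPullback_prodChart`, `isOpenImmersion_prodChart`,
`exists_prodChart_base_eq'`, `unitSlice_comp_prodChart`) and the chart Poincaré sheaves `𝒫ᵢ` (rigidified: field `rigid` of ★ `DualPair`),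
the Stein hypothesis being ★ `AbelianSchemeSteinOfNoetherian.baseChange_appTop_bijective` moved along Mathlib `pullbackLeftPullbackSndIso`
(`surjective_appTop_snd_of_prodLeft`), and feeds the output to the P-b assembly `nonempty_dualPair_of_charts`.

* `surjective_appTop_snd_of_prodLeft` — `(A ×_S H) ×_H T → T` is surjective on global functions (`S` locally Noetherian);
* **`nonempty_dualPair_of_gluedHat_of_compat`** — given the glued hat `(H, χ, hχ)` of chart dual pairs `Eᵢ` and the CHART COMPATIBILITY
  (for every test object `(A ×_S H) ×_H T` and two chart readings `mᵢ`, `mⱼ` over `A ×_S H`, `mᵢ^*𝒫ᵢ ≅ mⱼ^*𝒫ⱼ` — the (a2) letter, owed: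
  it follows from FILE H's Poincaré clause of the hat transitions and the glue condition of `exists_gluedHat`), `A` HAS A DUAL PAIR.

So `stub_F3Z` = ★-shaped `exists_gluedHat` (B-p18 (g21)) + the (a2) compatibility letter + this file.  HC_CM is proved only modulo the 7
printed citations until rung 0 closes; this file discharges none of them (count-neutral capital).

## References
* [BoschLutkebohmertRaynaud1990] S. Bosch, W. Lütkebohmert, M. Raynaud, *Néron Models* (1990), §8.1 Prop. 4.
* [MumfordAV1970] D. Mumford, *Abelian Varieties* (1970), §13 (proof of the Thm. p. 125).
* [MumfordFogartyKirwan1994] D. Mumford, J. Fogarty, F. Kirwan, *Geometric Invariant Theory*, 3rd ed. (1994), Ch. 6 §1 Cor. 6.8 (p. 118).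
* [GortzWedhorn2023] U. Görtz, T. Wedhorn, *Algebraic Geometry II* (2023), Cor. 24.63 (p. 404) (Stein property of abelian schemes).
-/

set_option autoImplicit false

-- `Scheme.Modules` / the `Over`-structure maps of ★ `baseChange` are not reducible (as in ★ `PoincareUniversalLocality`).
set_option backward.isDefEq.respectTransparency false

noncomputable section

universe u

open CategoryTheory CategoryTheory.Limits AlgebraicGeometry MonoidalCategory
open Literature.AlgebraicGeometry.Motives Literature.AlgebraicGeometry.AbelianVarieties Literature.AlgebraicGeometry.Modules

namespace Literature.AlgebraicGeometry.AbelianSchemes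

namespace AbelianSchemeOver

variable {S : Scheme.{u}} (A : AbelianSchemeOver S)

/-- **`(A ×_S H) ×_H T → T` is surjective on global functions** for `S` locally Noetherian: `(A ×_S H) ×_H T ≅ A ×_S T` over `T`
(Mathlib `pullbackLeftPullbackSndIso`) and `A_T → T` is Stein (★ `baseChange_appTop_bijective`). [cite: GortzWedhorn2023, Cor. 24.63 (p. 404)] -/
theorem surjective_appTop_snd_of_prodLeft [IsLocallyNoetherian S] (H : AbelianSchemeOver S) {T : Scheme.{u}} (b : T ⟶ H.X.left) :
    Function.Surjective (pullback.snd (pullback.snd A.X.hom H.X.hom) b).appTop := by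
  have h : pullback.snd (pullback.snd A.X.hom H.X.hom) b =
      (pullbackLeftPullbackSndIso A.X.hom H.X.hom b).hom ≫ pullback.snd A.X.hom (b ≫ H.X.hom) :=
    (pullbackLeftPullbackSndIso_hom_snd A.X.hom H.X.hom b).symm
  rw [h, Scheme.Hom.comp_appTop]
  exact (ConcreteCategory.bijective_of_isIso (pullbackLeftPullbackSndIso A.X.hom H.X.hom b).hom.appTop).2.comp
    (A.baseChange_appTop_bijective (b ≫ H.X.hom)).2

variable (𝒰 : Scheme.OpenCover.{u} S) (E : ∀ i, (A.baseChange (𝒰.f i)).DualPair) (H : AbelianSchemeOver S)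
  (χ : ∀ i, (E i).hat.X.left ⟶ H.X.left) (hχ : ∀ i, (E i).hat.IsBaseChangeVia H (𝒰.f i) (χ i))

/-- **A DUAL PAIR OF `A` FROM A GLUED HAT, MODULO CHART COMPATIBILITY** ([BoschLutkebohmertRaynaud1990, §8.1 Prop. 4] effectivity, in
B-p15 (g15)'s form `Modules.exists_hasRank_one_of_rigidified_baseCover`, then the P-b assembly `nonempty_dualPair_of_charts`): the
engine's data are the product charts `Ξᵢ` (cartesian over the `χᵢ`, open immersions, covering `A ×_S H`), their unit slices
`ε_{Aᵢ} × 1` (mapping to `ε_A × 1_H`, `unitSlice_comp_prodChart`), the chart Poincaré sheaves with their rigidifications (field `rigid`),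
and the Stein hypothesis (`surjective_appTop_snd_of_prodLeft`); the one hypothesis left is the chart compatibility `hcompat`.
[cite: BoschLutkebohmertRaynaud1990, §8.1 Prop. 4] [cite: MumfordAV1970, §13 (proof of the Thm. p. 125)] [cite: MumfordFogartyKirwan1994, Ch. 6 §1 Cor. 6.8 (p. 118)] -/
theorem nonempty_dualPair_of_gluedHat_of_compat [IsLocallyNoetherian S]
    (hcompat : ∀ ⦃T : Scheme.{u}⦄ (b : T ⟶ H.X.left) (i j : 𝒰.I₀)
      (mi : pullback (pullback.snd A.X.hom H.X.hom) b ⟶ (A.baseChange (𝒰.f i)).prodLeft (E i).hat)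
      (mj : pullback (pullback.snd A.X.hom H.X.hom) b ⟶ (A.baseChange (𝒰.f j)).prodLeft (E j).hat),
      mi ≫ A.prodChart 𝒰 E H χ hχ i = pullback.fst (pullback.snd A.X.hom H.X.hom) b →
      mj ≫ A.prodChart 𝒰 E H χ hχ j = pullback.fst (pullback.snd A.X.hom H.X.hom) b →
      Nonempty ((Scheme.Modules.pullback mi).obj (E i).P ≅ (Scheme.Modules.pullback mj).obj (E j).P)) :
    Nonempty A.DualPair := by
  haveI : ∀ i, IsOpenImmersion (χ i) := fun i => A.isOpenImmersion_chart 𝒰 E H χ hχ i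
  haveI : ∀ i, IsOpenImmersion (A.prodChart 𝒰 E H χ hχ i) := fun i => A.isOpenImmersion_prodChart 𝒰 E H χ hχ i
  obtain ⟨P, h1, hP⟩ := exists_hasRank_one_of_rigidified_baseCover (pullback.snd A.X.hom H.X.hom) (A.unitSlice H)
    (A.unitSlice_snd H) (fun i => (E i).hat.X.left) χ (fun i => (A.baseChange (𝒰.f i)).prodLeft (E i).hat)
    (fun i => A.prodChart 𝒰 E H χ hχ i) (fun i => pullback.snd (A.baseChange (𝒰.f i)).X.hom (E i).hat.X.hom)
    (fun i => (A.isPullback_prodChart 𝒰 E H χ hχ i).flip)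
    (fun x => by
      obtain ⟨i, z, hz⟩ := A.exists_prodChart_base_eq' 𝒰 E H χ hχ x
      exact ⟨i, z, hz⟩)
    (fun i => (A.baseChange (𝒰.f i)).unitSlice (E i).hat) (fun i => A.unitSlice_comp_prodChart 𝒰 E H χ hχ i)
    (fun i => (A.baseChange (𝒰.f i)).unitSlice_snd (E i).hat)
    (fun i => (E i).P) (fun i => (E i).hasRank_one) (fun i => (E i).rigid.some)
    (fun T b => A.surjective_appTop_snd_of_prodLeft H b) hcompat
  exact A.nonempty_dualPair_of_charts 𝒰 E H χ hχ P h1 hP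

end AbelianSchemeOver

end Literature.AlgebraicGeometry.AbelianSchemes

end
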